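import Literature.NumberTheory.EllipticCurves.SelmerLocalConditionGoodReductionAnyProofs
import Literature.NumberTheory.EllipticCurves.GreenbergVatsal2000.GreenbergSelmerGroups
import Literature.NumberTheory.EllipticCurves.SubgroupSelmerProofs
import Literature.NumberTheory.EllipticCurves.SubgroupSelmerCocycleCriteriaProofs
import Literature.NumberTheory.EllipticCurves.DiscreteH1Equiv
import HarnessLib

/-!
# The kernel of the `Σ`-localisation on `H¹(K_Σ/K, E[p^∞])` lies in the Selmer group: an UNRAMIFIED class at a
# good place `v` is locally trivial in `H¹(K_v, E(K̄_v))` (Milne I Prop. 3.8), `E[p^∞]`-coefficients, Greenberg–Vatsal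
# currency `unramifiedOutside ⊤ E[p^∞] p S₀`

Crux K4 `SignedControlAtTwo` (stmt-BirchSwinnertonDyer-20309; routes `ThetaPartnerAtTwo` / `ResidualThetaTransportAtTwo`),
line `eulerchar` v7 (stub `stub_pubGreenbergTwo` = PUB×4); width seat `prover-bsd-wall-tp2-p3-w3` g4. Part (K) of the
attempt on the PUB antecedent `Greenberg1999.h1Sigma_zpCorank_le_degree ℚ` (Greenberg, LNM 1716, pp. 119–120): the step
«`Sel_E(F)_p = ker(H¹(F_Σ/F, E[p^∞]) → 𝒫_E^Σ(F))`», in the inclusion direction that the corank count uses: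
**a class of `H¹(K_Σ/K, E[p^∞]) = unramifiedOutside ⊤ E[p^∞] p S₀` which is locally trivial at every `v ∈ Σ = S₀ ∪ {v ∣ p} ∪ ∞`
lies in `Sel_{p^∞}(E/K)`** — because at the remaining places `v` (good, `v ∤ p`) the class is unramified, and an unramified
class dies in `H¹(K_v, E(K̄_v))` (Milne, *ADT* I Prop. 3.8, `H¹(K_v^nr/K_v, E(K_v^nr)) = 0`; tree THEOREM
`Milne2006_unramifiedClass_eq_zero_holds`). This is the `E[p^∞]`-coefficient, Greenberg–Vatsal-currency twin of the tree's
`unramifiedKer_le_selmerLocalKer_of_hasGoodReductionAt` (`E[n]`-coefficients, Silverman currency).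

* §1 `mem_selmerLocalKerPrimary_of_res_mem_unramifiedKer` — for `c ∈ H¹(Γ_K, E[p^∞])`: if `res_⊤ c ∈ H¹(⊤, E[p^∞])` is
  unramified at the chosen place above a GOOD `v` (`GreenbergVatsal2000.unramifiedKer ⊤ E[p^∞] v`, i.e. dies on `⊤ ⊓ I_v`,
  `I_v = res(I_{K_v})`), then `c` dies in `H¹(Γ_{K_v}, E(K̄_v))` (`selmerLocalKerPrimary`);
* §2 `mem_localKerOver_top_of_mem_unramifiedKer` — the same at level `⊤` (`localKerOver p ⊤ K_v`);
* §3 `mem_selmerGroupOver_top_of_mem_unramifiedOutside` — unramified outside `Σ` + locally trivial on `Σ` ⇒ `∈ Sel_{p^∞}(E/K̄^⊤)`;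
  `finite_selmerGroupOver_top` — `Sel_{p^∞}(E/K̄^⊤)` is finite when `Sel_{p^∞}(E/K)` is (tree `selmerGroupOver_top_holds`).

THEOREMS ONLY (no definition, no named fact, no `sorry`); nothing about any curve is asserted; BSD is not proved by
any of this.

References: [GreenbergLNM1716] §2 pp. 71–72 (Prop. 2.1 context), §4 p. 104, pp. 119–120; [MilneADT2006] I Prop. 3.8;
[GreenbergVatsal2000] §2 pp. 16–17, 23.
-/

set_option autoImplicit false
-- the Theorems namespace of this sub repeats the summit name by design (D-0017 nested layout)
set_option linter.dupNamespace false

noncomputable section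

open scoped Classical NumberField

universe u

namespace Summit.BirchSwinnertonDyer.BirchSwinnertonDyer.Theorems.SignedEC.H1SigmaCorank

open NumberField IsDedekindDomain Field WeierstrassCurve
open Literature.NumberTheory.EllipticCurves Literature.NumberTheory.GaloisRepresentations
  Literature.NumberTheory.EllipticCurves.GreenbergVatsal2000 Literature.NumberTheory.EllipticCurves.GreenbergSelmer

variable {K : Type u} [Field K] [NumberField K] (W : WeierstrassCurve K) [W.IsElliptic] (p : ℕ)

/-! ## §1 Unramified at a good place ⟹ locally trivial (`E[p^∞]`-coefficients, level `Γ_K`) -/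

/-- **Milne I Prop. 3.8 for `E[p^∞]`-valued classes, Greenberg–Vatsal currency.** Let `v` be a finite place of GOOD
reduction and `c ∈ H¹(Γ_K, E[p^∞])`. If the restriction `res_⊤ c ∈ H¹(⊤, E[p^∞])` is unramified at the chosen place above
`v` (`GreenbergVatsal2000.unramifiedKer ⊤ E[p^∞] v`: it dies on `⊤ ⊓ I_v`, `I_v` the image of the local inertia group),
then `c` dies in `H¹(Γ_{K_v}, E(K̄_v))` (`selmerLocalKerPrimary W K_v p`). Proof: a cocycle `φ` of `c` is `x ↦ x•m − m` on
`I_v`; the local cocycle `σ ↦ ι_*φ(res σ)` minus the coboundary of `ι_* m` vanishes on the local inertia group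
(`= I_𝔐 = absInertia K_v`, tree `inertia_eq_absInertia`), hence is principal by `Milne2006_unramifiedClass_eq_zero_holds`.
[cite: MilneADT2006, Ch. I Prop. 3.8] [cite: GreenbergVatsal2000, §2 p. 17] -/
theorem mem_selmerLocalKerPrimary_of_res_mem_unramifiedKer {v : HeightOneSpectrum (𝓞 K)}
    (hv : W.HasGoodReductionAt v) (c : W.galH1Primary p)
    (hc : resH1Hom (Literature.NumberTheory.EllipticCurves.subgroupIncl (⊤ : Subgroup (absoluteGaloisGroup K)))
        (AddMonoidHom.id (geomPrimaryTorsion W p)) (fun _ _ ↦ rfl) c ∈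
      GreenbergVatsal2000.unramifiedKer (⊤ : Subgroup (absoluteGaloisGroup K)) (W.geomPrimaryTorsion p) v) :
    c ∈ selmerLocalKerPrimary W (v.adicCompletion K) p := by
  obtain ⟨φ, rfl⟩ :=
    oneCocycleClass_surjective (discreteTopRep (absoluteGaloisGroup K) (geomPrimaryTorsion W p)) c
  -- unpack the unramified condition on the cocycle
  rw [GreenbergVatsal2000.unramifiedKer, AddMonoidHom.mem_ker, resH1Hom_resH1Hom,
    CocycleCriteria.resH1Hom_oneCocycleClass_eq_zero_iff] at hc
  obtain ⟨m, hm⟩ := hc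
  -- the local data
  obtain ⟨wK, hwK⟩ := v.exists_spectralValuation
  obtain ⟨𝔐, h𝔐⟩ := v.localPrimesAbove_nonempty
  unfold selmerLocalKerPrimary
  rw [mem_resKer_iff, map_oneCocycleClass]
  -- the local point `ι_* m` and its coboundary
  set A : localPoints W (v.adicCompletion K) := pointsMap W (v.adicCompletion K) (m : geomPoints W) with hA
  set g := contOneCocycles.pullback (resGal (K := K) (v.adicCompletion K))
    (X := discreteTopRep (absoluteGaloisGroup K) (geomPrimaryTorsion W p))
    (Y := discreteTopRep (absoluteGaloisGroup (v.adicCompletion K)) (localPoints W (v.adicCompletion K)))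
    (resHomOfEquivariant (resGal (K := K) (v.adicCompletion K))
      ((pointsMap W (v.adicCompletion K)).comp (geomPrimaryTorsion W p).subtype)
      (W.pointsMap_comp_subtype_smul p)) φ with hg
  let cob : contOneCocycles (discreteTopRep (absoluteGaloisGroup (v.adicCompletion K))
      (localPoints W (v.adicCompletion K))) :=
    ⟨⟨fun σ ↦ σ • A - A, (continuous_smul_localPoints W _ A).sub continuous_const⟩, fun σ τ ↦ by
      change (σ * τ) • A - A = (σ • A - A) + σ • (τ • A - A)
      rw [mul_smul, smul_sub]; abel⟩
  have hcob : oneCocycleClass _ cob = 0 :=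
    (oneCocycleClass_eq_zero_iff _ cob).mpr ⟨A, fun _ ↦ rfl⟩
  -- `g - cob` vanishes on the local inertia group
  have hzero : oneCocycleClass _ (g - cob) = 0 := by
    refine Milne2006_unramifiedClass_eq_zero_holds W v hv h𝔐 _ fun σ hσ ↦ ?_
    -- `res σ ∈ I_v`, `res σ ∈ D_v`
    have hσabs : σ ∈ absInertia (v.adicCompletion K) := by
      rw [← HeightOneSpectrum.inertia_eq_absInertia hwK h𝔐]; exact hσ
    have hI : resGal (K := K) (v.adicCompletion K) σ ∈ inertia v :=
      Subgroup.mem_map_of_mem (absGaloisRestrict K (v.adicCompletion K)).toMonoidHom hσabs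
    have hD : resGal (K := K) (v.adicCompletion K) σ ∈ decomp v := ⟨σ, rfl⟩
    let x : inertiaIn (⊤ : Subgroup (absoluteGaloisGroup K)) v :=
      ⟨⟨resGal (K := K) (v.adicCompletion K) σ, hD⟩,
        (mem_inertiaIn_iff ⊤ v _).2 ⟨Subgroup.mem_top _, hI⟩⟩
    have h1 : φ.1 (resGal (K := K) (v.adicCompletion K) σ) = resGal (K := K) (v.adicCompletion K) σ • m - m :=
      hm x
    change g.1 σ - (σ • A - A) = 0
    rw [hg, contOneCocycles.pullback_apply, h1]
    change pointsMap W (v.adicCompletion K)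
        (((resGal (K := K) (v.adicCompletion K) σ • m - m : geomPrimaryTorsion W p) : geomPoints W)) -
        (σ • A - A) = 0
    rw [AddSubgroup.coe_sub, map_sub, Literature.NumberTheory.EllipticCurves.primaryComponent.coe_smul,
      pointsMap_smul W (v.adicCompletion K) σ, hA, sub_self]
  have : oneCocycleClass _ g = oneCocycleClass _ (g - cob) + oneCocycleClass _ cob := by
    rw [oneCocycleClass_sub, sub_add_cancel]
  rw [this, hzero, hcob, add_zero]

/-! ## §2 The same at level `⊤` -/

/-- **Unramified at a good place ⟹ in the local kernel `localKerOver p ⊤ K_v`** (level `⊤`, the currency of the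
Greenberg facts): every `y ∈ H¹(⊤, E[p^∞])` is `res_⊤ c` (`bijective_resH1Hom_subgroupIncl`), and
`res_⊤ c ∈ localKerOver p ⊤ K_v ↔ c ∈ selmerLocalKerPrimary W K_v p` (tree `resH1Hom_subgroupIncl_mem_localKerOver_top_iff`).
[cite: MilneADT2006, Ch. I Prop. 3.8] [cite: GreenbergLNM1716, §2 p. 72] -/
theorem mem_localKerOver_top_of_mem_unramifiedKer {v : HeightOneSpectrum (𝓞 K)} (hv : W.HasGoodReductionAt v)
    (y : W.subgroupH1 p (⊤ : Subgroup (absoluteGaloisGroup K)))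
    (hy : y ∈ GreenbergVatsal2000.unramifiedKer (⊤ : Subgroup (absoluteGaloisGroup K)) (W.geomPrimaryTorsion p) v) :
    y ∈ W.localKerOver p ⊤ (v.adicCompletion K) := by
  obtain ⟨c, rfl⟩ := (bijective_resH1Hom_subgroupIncl (geomPrimaryTorsion W p)
    (⊤ : Subgroup (absoluteGaloisGroup K)) Subgroup.mem_top).2 y
  rw [W.resH1Hom_subgroupIncl_mem_localKerOver_top_iff p]
  exact mem_selmerLocalKerPrimary_of_res_mem_unramifiedKer W p hv c hy

/-! ## §3 Unramified outside `Σ` and locally trivial on `Σ` ⟹ Selmer -/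

/-- **`ker(H¹(K_Σ/K, E[p^∞]) → 𝒫_E^Σ(K)) ⊆ Sel_{p^∞}(E/K)`** (Greenberg p. 119: «`Sel_E(F)_p = ker(H¹(F_Σ/F, E[p^∞]) → 𝒫_E^Σ(F))`»,
the inclusion `⊇` read at level `⊤`): if `y ∈ unramifiedOutside ⊤ E[p^∞] p S₀` (good reduction off `S₀ ∪ {v ∣ p}`) has
`localResOver p ⊤ K_v y = 0` for every finite `v ∈ S₀ ∪ {v ∣ p}` and `localResOver p ⊤ K_w y = 0` for every infinite `w`,
then `y ∈ Sel_{p^∞}(E/K̄^⊤) = selmerGroupOver p ⊤` (at the other finite places §2 applies; `conj_σ = id` at level `⊤`).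
[cite: GreenbergLNM1716, §4 p. 119] [cite: MilneADT2006, Ch. I Prop. 3.8] -/
theorem mem_selmerGroupOver_top_of_mem_unramifiedOutside {S₀ : Set (HeightOneSpectrum (𝓞 K))}
    (hgood : ∀ v : HeightOneSpectrum (𝓞 K), v ∉ S₀ → ((p : ℕ) : 𝓞 K) ∉ v.asIdeal → W.HasGoodReductionAt v)
    (y : W.subgroupH1 p (⊤ : Subgroup (absoluteGaloisGroup K)))
    (hy : y ∈ unramifiedOutside (⊤ : Subgroup (absoluteGaloisGroup K)) (W.geomPrimaryTorsion p) p S₀)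
    (hloc : ∀ v : HeightOneSpectrum (𝓞 K), (v ∈ S₀ ∨ ((p : ℕ) : 𝓞 K) ∈ v.asIdeal) →
      W.localResOver p ⊤ (v.adicCompletion K) y = 0)
    (hinf : ∀ w : InfinitePlace K, W.localResOver p ⊤ w.Completion y = 0) :
    y ∈ W.selmerGroupOver p (⊤ : Subgroup (absoluteGaloisGroup K)) := by
  have hconj : ∀ σ : absoluteGaloisGroup K, W.conjH1 p ⊤ σ y = y := fun σ ↦ by
    rw [W.conjH1_of_mem_holds p ⊤ (Subgroup.mem_top σ), AddMonoidHom.id_apply]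
  rw [W.mem_selmerGroupOver_iff p ⊤]
  refine ⟨fun v σ ↦ ?_, fun w σ ↦ ?_⟩
  · rw [hconj]
    by_cases hvS : v ∈ S₀ ∨ ((p : ℕ) : 𝓞 K) ∈ v.asIdeal
    · exact (W.mem_localKerOver_iff p ⊤ _ y).2 (hloc v hvS)
    · rw [not_or] at hvS
      refine mem_localKerOver_top_of_mem_unramifiedKer W p (hgood v hvS.1 hvS.2) y ?_
      have h := (mem_unramifiedOutside_iff y).1 hy v hvS.1 hvS.2 1
      rwa [show Literature.NumberTheory.EllipticCurves.conjH1 ⊤ (W.geomPrimaryTorsion p) 1 = AddMonoidHom.id _ from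
        conjH1_of_mem_holds ⊤ _ (one_mem _), AddMonoidHom.id_apply] at h
  · rw [hconj]
    exact (W.mem_localKerOver_iff p ⊤ _ y).2 (hinf w)

omit [W.IsElliptic] in
/-- **`Sel_{p^∞}(E/K̄^⊤)` is finite when `Sel_{p^∞}(E/K)` is** (tree isomorphism `selmerGroupOver_top_holds`).
[cite: GreenbergLNM1716, §2] -/
theorem finite_selmerGroupOver_top [Finite (W.selmerGroupPInfty p)] :
    Finite (W.selmerGroupOver p (⊤ : Subgroup (absoluteGaloisGroup K))) := by
  obtain ⟨f⟩ := W.selmerGroupOver_top_holds p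
  exact Finite.of_equiv _ f.symm.toEquiv

end Summit.BirchSwinnertonDyer.BirchSwinnertonDyer.Theorems.SignedEC.H1SigmaCorank

end
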